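import Summits.QuantumFields.BalabanUV.Beta.D1BFx.PackedCoframeSep

/-!
# BetaPertH road «BF-x» — «COFRAME-MASS» M1j: two-centre `dSw` and the tip jets against a BI-LOCALISED site kernel, WITH SEPARATION

STATUS: [folklore] `ℓ¹` bookkeeping for the road's (A1)-PACKED identity (BINDER row D1, slot (K)); NOT an estimate of Bałaban's, NOT a discharge of any
root-level binder.  Provenance: reconstruction; the manuscript(s) under audit are NOT citable.

WHAT (all [folklore]): `biLoc_dSw₂` (RJetAssembly's `biLoc_dSw` with two centres, the separation factor `E` kept visible); **`biLoc_jetCw_of_biLoc`** —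
`|ω β z| ≤ Cw·e^{−δ|z−P′|}`, `BiLoc Y p q K ρ`, `0 ≤ ρ ≤ δ` ⊢ `BiLoc (jetCw ω Y) p P′ (2·Cw·K·e^{2ρ}·e^{−(ρ∕2)|q−P′|}) (ρ∕2)` (the tip weight's decay and
the kernel's column localisation meet at `z` — that is the separation); its row twin `biLoc_jetRw_of_biLoc`; **`biLoc_jetRCw_sep`** —
`BiLoc (jetRCw ω ω′ Y) P P′ (Cw·Cw′·CY·e^{2δ}·e^{−(δ∕2)|P−P′|}) (δ∕2)` for a decaying `Y` (triangle `P → x → z → P′`).  Versus P1b's `biLoc_jet•_of_decays`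
(`Y` translation-spread, ONE centre): here `Y` is bi-localised and the weight sits at another point.
Unit `b2b-balaban-beta-d1-formalise-leaf-03` (gen 24); road owner `b2b-balaban-beta-d1-p2`.
-/

noncomputable section

namespace Summit.QuantumFields.BalabanUV.Beta.D1BFx.PackedCoframeSepJets

open scoped BigOperators
open Literature.MathematicalPhysics.QuantumFieldTheory.Balaban1983to89
open Literature.MathematicalPhysics.QuantumFieldTheory.Balaban1983to89.Beta
open B12Sec2to5 (l1 l1_nonneg)
open ExpKernelCalculus (Site MKer BiLoc Decays l1_sub_triangle l1_sub_symm)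
open AffineAveraging (unitVec)
open Summit.QuantumFields.BalabanUV.Beta.D1BFx.RJetProjector (Rgt)
open Summit.QuantumFields.BalabanUV.Beta.D1BFx.RJetAssembly (dSw exp_le_of_l1_le l1_sub_le_shift_left l1_sub_le_shift_right)
open Summit.QuantumFields.BalabanUV.Beta.D1BFx.GhostStencil (l1_zero l1_unitVec)
open Summit.QuantumFields.BalabanUV.Beta.D1BFx.PackedPinnedLetters (jetRw jetCw jetRCw jetRw_apply jetCw_apply jetRCw_apply)

/-! ### Two-centre `dSw` and the tip jets against a bi-localised site kernel -/

/-- [folklore] **TWO-CENTRE `dSw`** (RJetAssembly's `biLoc_dSw` with distinct centres): `BiLoc Y p q (K₀·E) δ ⇒ BiLoc (dSw Y) p q (4·K₀·e^{2δ}·E) δ`. -/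
theorem biLoc_dSw₂ {Y : MKer 4 Unit} {p q : Site 4} {K₀ E δ : ℝ} (hδ : 0 ≤ δ) (hY : BiLoc Y p q (K₀ * E) δ) :
    BiLoc (dSw Y) p q (4 * K₀ * Real.exp (2 * δ) * E) δ := by
  intro x z α β
  have hC : 0 ≤ K₀ * E := hY.nonneg ()
  have hex : 1 ≤ Real.exp δ := Real.one_le_exp hδ
  have wx := exp_le_of_l1_le hδ (l1_sub_le_shift_left p x α)
  have wz := exp_le_of_l1_le hδ (l1_sub_le_shift_left q z β)
  rw [mul_one] at wx wz
  have wx0 : Real.exp (-δ * l1 (x - p)) ≤ Real.exp δ * Real.exp (-δ * l1 (x - p)) :=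
    le_mul_of_one_le_left (Real.exp_pos _).le hex
  have wz0 : Real.exp (-δ * l1 (z - q)) ≤ Real.exp δ * Real.exp (-δ * l1 (z - q)) :=
    le_mul_of_one_le_left (Real.exp_pos _).le hex
  have key : ∀ x' z' : Site 4, Real.exp (-δ * l1 (x' - p)) ≤ Real.exp δ * Real.exp (-δ * l1 (x - p)) →
      Real.exp (-δ * l1 (z' - q)) ≤ Real.exp δ * Real.exp (-δ * l1 (z - q)) →
      |Y x' z' () ()| ≤ K₀ * E * Real.exp (2 * δ) * (Real.exp (-δ * l1 (x - p)) * Real.exp (-δ * l1 (z - q))) := by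
    intro x' z' hp hq
    refine (hY x' z' () ()).trans ?_
    rw [mul_add, Real.exp_add]
    calc K₀ * E * (Real.exp (-δ * l1 (x' - p)) * Real.exp (-δ * l1 (z' - q)))
        ≤ K₀ * E * ((Real.exp δ * Real.exp (-δ * l1 (x - p))) * (Real.exp δ * Real.exp (-δ * l1 (z - q)))) :=
          mul_le_mul_of_nonneg_left (mul_le_mul hp hq (Real.exp_pos _).le (by positivity)) hC
      _ = K₀ * E * Real.exp (2 * δ) * (Real.exp (-δ * l1 (x - p)) * Real.exp (-δ * l1 (z - q))) := by
          rw [two_mul, Real.exp_add]; ring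
  have t1 := key _ _ wx wz
  have t2 := key _ _ wx wz0
  have t3 := key _ _ wx0 wz
  have t4 := key _ _ wx0 wz0
  rw [RJetAssembly.dSw_apply, mul_add (-δ), Real.exp_add]
  have i1 := abs_add_le (Y (x + unitVec α) (z + unitVec β) () () - Y (x + unitVec α) z () () - Y x (z + unitVec β) () ())
    (Y x z () ())
  have i2 := abs_sub (Y (x + unitVec α) (z + unitVec β) () () - Y (x + unitVec α) z () ()) (Y x (z + unitVec β) () ())
  have i3 := abs_sub (Y (x + unitVec α) (z + unitVec β) () ()) (Y (x + unitVec α) z () ())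
  nlinarith [t1, t2, t3, t4, i1, i2, i3]

/-- [folklore] **COLUMN TIP JET AGAINST A BI-LOCALISED SITE KERNEL, WEIGHT AT ANOTHER CENTRE**: `|ω β z| ≤ Cw·e^{−δ|z−P′|}`,
`BiLoc Y p q K ρ`, `0 ≤ ρ ≤ δ` ⊢ `BiLoc (jetCw ω Y) p P′ (2·Cw·K·e^{2ρ}·e^{−(ρ∕2)|q−P′|}) (ρ∕2)` — the weight's decay and the kernel's column
localisation meet at `z`, which gives the separation `|q − P′|`. -/
theorem biLoc_jetCw_of_biLoc {ω : Fin 4 → (Fin 4 → ℤ) → ℝ} {Y : MKer 4 Unit} {p q P' : Site 4} {Cw K δ ρ : ℝ}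
    (hω : ∀ β z, |ω β z| ≤ Cw * Real.exp (-δ * l1 (z - P'))) (hY : BiLoc Y p q K ρ) (hρ : 0 ≤ ρ) (hρδ : ρ ≤ δ) :
    BiLoc (jetCw ω Y) p P' (2 * Cw * K * Real.exp (2 * ρ) * Real.exp (-(ρ / 2) * l1 (q - P'))) (ρ / 2) := by
  intro x z α β
  have hK : 0 ≤ K := hY.nonneg ()
  have hCw : 0 ≤ Cw := (abs_nonneg (ω β P')).trans ((hω β P').trans_eq (by rw [sub_self, l1_zero, mul_zero, Real.exp_zero, mul_one]))
  -- the two kernel entries, brought back to `(x, z)`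
  have wx := exp_le_of_l1_le hρ (l1_sub_le_shift_left p x α)
  have wz := exp_le_of_l1_le hρ (l1_sub_le_shift_left q z β)
  rw [mul_one] at wx wz
  have hex : 1 ≤ Real.exp ρ := Real.one_le_exp hρ
  have wx0 : Real.exp (-ρ * l1 (x - p)) ≤ Real.exp ρ * Real.exp (-ρ * l1 (x - p)) :=
    le_mul_of_one_le_left (Real.exp_pos _).le hex
  have key : ∀ x' : Site 4, Real.exp (-ρ * l1 (x' - p)) ≤ Real.exp ρ * Real.exp (-ρ * l1 (x - p)) →
      |Y x' (z + unitVec β) () ()| ≤ K * Real.exp (2 * ρ) * (Real.exp (-ρ * l1 (x - p)) * Real.exp (-ρ * l1 (z - q))) := by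
    intro x' hp
    refine (hY x' (z + unitVec β) () ()).trans ?_
    rw [mul_add, Real.exp_add]
    calc K * (Real.exp (-ρ * l1 (x' - p)) * Real.exp (-ρ * l1 (z + unitVec β - q)))
        ≤ K * ((Real.exp ρ * Real.exp (-ρ * l1 (x - p))) * (Real.exp ρ * Real.exp (-ρ * l1 (z - q)))) :=
          mul_le_mul_of_nonneg_left (mul_le_mul hp wz (Real.exp_pos _).le (by positivity)) hK
      _ = K * Real.exp (2 * ρ) * (Real.exp (-ρ * l1 (x - p)) * Real.exp (-ρ * l1 (z - q))) := by
          rw [two_mul, Real.exp_add]; ring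
  have t1 := key _ wx
  have t2 := key _ wx0
  -- the separation split at `z`: `e^{−ρ|z−q|}·e^{−δ|z−P′|} ≤ e^{−(ρ∕2)|q−P′|}·e^{−(ρ∕2)|z−P′|}`
  have hsplit : Real.exp (-ρ * l1 (z - q)) * Real.exp (-δ * l1 (z - P'))
      ≤ Real.exp (-(ρ / 2) * l1 (q - P')) * Real.exp (-(ρ / 2) * l1 (z - P')) := by
    rw [← Real.exp_add, ← Real.exp_add]
    refine Real.exp_le_exp.mpr ?_
    have ht : l1 (q - P') ≤ l1 (z - q) + l1 (z - P') := by
      have h := l1_sub_triangle q z P'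
      rwa [l1_sub_symm q z] at h
    nlinarith [l1_nonneg (z - q), l1_nonneg (z - P'), l1_nonneg (q - P')]
  rw [jetCw_apply, abs_mul]
  have hd : |Y (x + unitVec α) (z + unitVec β) () () - Y x (z + unitVec β) () ()|
      ≤ 2 * (K * Real.exp (2 * ρ) * (Real.exp (-ρ * l1 (x - p)) * Real.exp (-ρ * l1 (z - q)))) := by
    have i := abs_sub (Y (x + unitVec α) (z + unitVec β) () ()) (Y x (z + unitVec β) () ())
    linarith
  calc |ω β z| * |Y (x + unitVec α) (z + unitVec β) () () - Y x (z + unitVec β) () ()|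
      ≤ (Cw * Real.exp (-δ * l1 (z - P'))) * (2 * (K * Real.exp (2 * ρ) * (Real.exp (-ρ * l1 (x - p)) * Real.exp (-ρ * l1 (z - q))))) :=
        mul_le_mul (hω β z) hd (abs_nonneg _) (mul_nonneg hCw (Real.exp_pos _).le)
    _ = 2 * Cw * K * Real.exp (2 * ρ) * Real.exp (-ρ * l1 (x - p)) * (Real.exp (-ρ * l1 (z - q)) * Real.exp (-δ * l1 (z - P'))) := by ring
    _ ≤ 2 * Cw * K * Real.exp (2 * ρ) * Real.exp (-ρ * l1 (x - p)) * (Real.exp (-(ρ / 2) * l1 (q - P')) * Real.exp (-(ρ / 2) * l1 (z - P'))) :=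
        mul_le_mul_of_nonneg_left hsplit (by positivity)
    _ ≤ 2 * Cw * K * Real.exp (2 * ρ) * Real.exp (-(ρ / 2) * l1 (x - p)) * (Real.exp (-(ρ / 2) * l1 (q - P')) * Real.exp (-(ρ / 2) * l1 (z - P'))) := by
        refine mul_le_mul_of_nonneg_right (mul_le_mul_of_nonneg_left (Real.exp_le_exp.mpr ?_) (by positivity)) (by positivity)
        nlinarith [l1_nonneg (x - p)]
    _ = 2 * Cw * K * Real.exp (2 * ρ) * Real.exp (-(ρ / 2) * l1 (q - P')) * Real.exp (-(ρ / 2) * (l1 (x - p) + l1 (z - P'))) := by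
        rw [mul_add, Real.exp_add]; ring

/-- [folklore] **ROW TIP JET, WEIGHT AT ANOTHER CENTRE** (row twin): `|ω α x| ≤ Cw·e^{−δ|x−P|}`, `BiLoc Y p q K ρ`, `0 ≤ ρ ≤ δ` ⊢
`BiLoc (jetRw ω Y) P q (2·Cw·K·e^{2ρ}·e^{−(ρ∕2)|p−P|}) (ρ∕2)`. -/
theorem biLoc_jetRw_of_biLoc {ω : Fin 4 → (Fin 4 → ℤ) → ℝ} {Y : MKer 4 Unit} {p q P : Site 4} {Cw K δ ρ : ℝ}
    (hω : ∀ α x, |ω α x| ≤ Cw * Real.exp (-δ * l1 (x - P))) (hY : BiLoc Y p q K ρ) (hρ : 0 ≤ ρ) (hρδ : ρ ≤ δ) :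
    BiLoc (jetRw ω Y) P q (2 * Cw * K * Real.exp (2 * ρ) * Real.exp (-(ρ / 2) * l1 (p - P))) (ρ / 2) := by
  intro x z α β
  have hK : 0 ≤ K := hY.nonneg ()
  have hCw : 0 ≤ Cw := (abs_nonneg (ω α P)).trans ((hω α P).trans_eq (by rw [sub_self, l1_zero, mul_zero, Real.exp_zero, mul_one]))
  have wx := exp_le_of_l1_le hρ (l1_sub_le_shift_left p x α)
  have wz := exp_le_of_l1_le hρ (l1_sub_le_shift_left q z β)
  rw [mul_one] at wx wz
  have hex : 1 ≤ Real.exp ρ := Real.one_le_exp hρ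
  have wz0 : Real.exp (-ρ * l1 (z - q)) ≤ Real.exp ρ * Real.exp (-ρ * l1 (z - q)) :=
    le_mul_of_one_le_left (Real.exp_pos _).le hex
  have key : ∀ z' : Site 4, Real.exp (-ρ * l1 (z' - q)) ≤ Real.exp ρ * Real.exp (-ρ * l1 (z - q)) →
      |Y (x + unitVec α) z' () ()| ≤ K * Real.exp (2 * ρ) * (Real.exp (-ρ * l1 (x - p)) * Real.exp (-ρ * l1 (z - q))) := by
    intro z' hq
    refine (hY (x + unitVec α) z' () ()).trans ?_
    rw [mul_add, Real.exp_add]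
    calc K * (Real.exp (-ρ * l1 (x + unitVec α - p)) * Real.exp (-ρ * l1 (z' - q)))
        ≤ K * ((Real.exp ρ * Real.exp (-ρ * l1 (x - p))) * (Real.exp ρ * Real.exp (-ρ * l1 (z - q)))) :=
          mul_le_mul_of_nonneg_left (mul_le_mul wx hq (Real.exp_pos _).le (by positivity)) hK
      _ = K * Real.exp (2 * ρ) * (Real.exp (-ρ * l1 (x - p)) * Real.exp (-ρ * l1 (z - q))) := by
          rw [two_mul, Real.exp_add]; ring
  have t1 := key _ wz
  have t2 := key _ wz0
  have hsplit : Real.exp (-ρ * l1 (x - p)) * Real.exp (-δ * l1 (x - P))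
      ≤ Real.exp (-(ρ / 2) * l1 (p - P)) * Real.exp (-(ρ / 2) * l1 (x - P)) := by
    rw [← Real.exp_add, ← Real.exp_add]
    refine Real.exp_le_exp.mpr ?_
    have ht : l1 (p - P) ≤ l1 (x - p) + l1 (x - P) := by
      have h := l1_sub_triangle p x P
      rwa [l1_sub_symm p x] at h
    nlinarith [l1_nonneg (x - p), l1_nonneg (x - P), l1_nonneg (p - P)]
  rw [jetRw_apply, abs_mul]
  have hd : |Y (x + unitVec α) (z + unitVec β) () () - Y (x + unitVec α) z () ()|
      ≤ 2 * (K * Real.exp (2 * ρ) * (Real.exp (-ρ * l1 (x - p)) * Real.exp (-ρ * l1 (z - q)))) := by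
    have i := abs_sub (Y (x + unitVec α) (z + unitVec β) () ()) (Y (x + unitVec α) z () ())
    linarith
  calc |ω α x| * |Y (x + unitVec α) (z + unitVec β) () () - Y (x + unitVec α) z () ()|
      ≤ (Cw * Real.exp (-δ * l1 (x - P))) * (2 * (K * Real.exp (2 * ρ) * (Real.exp (-ρ * l1 (x - p)) * Real.exp (-ρ * l1 (z - q))))) :=
        mul_le_mul (hω α x) hd (abs_nonneg _) (mul_nonneg hCw (Real.exp_pos _).le)
    _ = 2 * Cw * K * Real.exp (2 * ρ) * Real.exp (-ρ * l1 (z - q)) * (Real.exp (-ρ * l1 (x - p)) * Real.exp (-δ * l1 (x - P))) := by ring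
    _ ≤ 2 * Cw * K * Real.exp (2 * ρ) * Real.exp (-ρ * l1 (z - q)) * (Real.exp (-(ρ / 2) * l1 (p - P)) * Real.exp (-(ρ / 2) * l1 (x - P))) :=
        mul_le_mul_of_nonneg_left hsplit (by positivity)
    _ ≤ 2 * Cw * K * Real.exp (2 * ρ) * Real.exp (-(ρ / 2) * l1 (z - q)) * (Real.exp (-(ρ / 2) * l1 (p - P)) * Real.exp (-(ρ / 2) * l1 (x - P))) := by
        refine mul_le_mul_of_nonneg_right (mul_le_mul_of_nonneg_left (Real.exp_le_exp.mpr ?_) (by positivity)) (by positivity)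
        nlinarith [l1_nonneg (z - q)]
    _ = 2 * Cw * K * Real.exp (2 * ρ) * Real.exp (-(ρ / 2) * l1 (p - P)) * Real.exp (-(ρ / 2) * (l1 (x - P) + l1 (z - q))) := by
        rw [mul_add, Real.exp_add]; ring

/-- [folklore] **THE TWO-TIP TABLE WITH SEPARATION**: `|ω α x| ≤ Cw·e^{−δ|x−P|}`, `|ω′ β z| ≤ Cw′·e^{−δ|z−P′|}`, `Decays Y CY δ`, `0 ≤ δ` ⊢
`BiLoc (jetRCw ω ω′ Y) P P′ (Cw·Cw′·CY·e^{2δ}·e^{−(δ∕2)|P−P′|}) (δ∕2)` (triangle `P → x → z → P′`). -/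
theorem biLoc_jetRCw_sep {ω ω' : Fin 4 → (Fin 4 → ℤ) → ℝ} {Y : MKer 4 Unit} {P P' : Site 4} {Cw Cw' CY δ : ℝ}
    (hω : ∀ α x, |ω α x| ≤ Cw * Real.exp (-δ * l1 (x - P))) (hω' : ∀ β z, |ω' β z| ≤ Cw' * Real.exp (-δ * l1 (z - P')))
    (hY : Decays Y CY δ) (hδ : 0 ≤ δ) :
    BiLoc (jetRCw ω ω' Y) P P' (Cw * Cw' * CY * Real.exp (2 * δ) * Real.exp (-(δ / 2) * l1 (P - P'))) (δ / 2) := by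
  intro x z α β
  have hCw : 0 ≤ Cw := (abs_nonneg (ω α P)).trans ((hω α P).trans_eq (by rw [sub_self, l1_zero, mul_zero, Real.exp_zero, mul_one]))
  have hCw' : 0 ≤ Cw' := (abs_nonneg (ω' β P')).trans ((hω' β P').trans_eq (by rw [sub_self, l1_zero, mul_zero, Real.exp_zero, mul_one]))
  have hCY : 0 ≤ CY := hY.nonneg ()
  -- the kernel entry back to `(x, z)`: `|x + e_α − (z + e_β)|₁ ≥ |x − z|₁ − 2`
  have hYe : |Y (x + unitVec α) (z + unitVec β) () ()| ≤ CY * Real.exp (2 * δ) * Real.exp (-δ * l1 (x - z)) := by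
    refine (hY _ _ () ()).trans ?_
    have ht : l1 (x - z) ≤ l1 (x + unitVec α - (z + unitVec β)) + 2 := by
      have h1 := l1_sub_triangle x (x + unitVec α) z
      have h2 := l1_sub_triangle (x + unitVec α) (z + unitVec β) z
      have e1 : l1 (x - (x + unitVec α)) = 1 := by
        rw [l1_sub_symm, add_sub_cancel_left]; exact l1_unitVec α
      have e2 : l1 (z + unitVec β - z) = 1 := by
        rw [add_sub_cancel_left]; exact l1_unitVec β
      linarith
    have w := exp_le_of_l1_le hδ ht
    calc CY * Real.exp (-δ * l1 (x + unitVec α - (z + unitVec β))) ≤ CY * (Real.exp (δ * 2) * Real.exp (-δ * l1 (x - z))) :=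
          mul_le_mul_of_nonneg_left w hCY
      _ = CY * Real.exp (2 * δ) * Real.exp (-δ * l1 (x - z)) := by rw [mul_comm δ 2]; ring
  -- the separation split `P → x → z → P′`
  have hsplit : Real.exp (-δ * l1 (x - P)) * Real.exp (-δ * l1 (z - P')) * Real.exp (-δ * l1 (x - z))
      ≤ Real.exp (-(δ / 2) * l1 (P - P')) * Real.exp (-(δ / 2) * (l1 (x - P) + l1 (z - P'))) := by
    rw [← Real.exp_add, ← Real.exp_add, ← Real.exp_add]
    refine Real.exp_le_exp.mpr ?_
    have ht : l1 (P - P') ≤ l1 (x - P) + l1 (x - z) + l1 (z - P') := by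
      have h1 := l1_sub_triangle P x P'
      have h2 := l1_sub_triangle x z P'
      rw [l1_sub_symm P x] at h1
      linarith
    nlinarith [l1_nonneg (x - P), l1_nonneg (z - P'), l1_nonneg (x - z), l1_nonneg (P - P')]
  rw [jetRCw_apply, abs_mul, abs_mul]
  calc |ω α x| * |ω' β z| * |Y (x + unitVec α) (z + unitVec β) () ()|
      ≤ (Cw * Real.exp (-δ * l1 (x - P))) * (Cw' * Real.exp (-δ * l1 (z - P'))) * (CY * Real.exp (2 * δ) * Real.exp (-δ * l1 (x - z))) :=
        mul_le_mul (mul_le_mul (hω α x) (hω' β z) (abs_nonneg _) (mul_nonneg hCw (Real.exp_pos _).le)) hYe (abs_nonneg _)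
          (mul_nonneg (mul_nonneg hCw (Real.exp_pos _).le) (mul_nonneg hCw' (Real.exp_pos _).le))
    _ = Cw * Cw' * CY * Real.exp (2 * δ) * (Real.exp (-δ * l1 (x - P)) * Real.exp (-δ * l1 (z - P')) * Real.exp (-δ * l1 (x - z))) := by ring
    _ ≤ Cw * Cw' * CY * Real.exp (2 * δ) * (Real.exp (-(δ / 2) * l1 (P - P')) * Real.exp (-(δ / 2) * (l1 (x - P) + l1 (z - P')))) :=
        mul_le_mul_of_nonneg_left hsplit (by positivity)
    _ = Cw * Cw' * CY * Real.exp (2 * δ) * Real.exp (-(δ / 2) * l1 (P - P')) * Real.exp (-(δ / 2) * (l1 (x - P) + l1 (z - P'))) := by ring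

end Summit.QuantumFields.BalabanUV.Beta.D1BFx.PackedCoframeSepJets

end
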